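import Literature.IUT.HodgeTheaters.ProfiniteCompletionQuotients
import Mathlib.Topology.Instances.ZMod
import Mathlib.Topology.DenseEmbedding
import HarnessLib

/-!
# [IUTchI] §2 plumbing for Lemma 2.7 (v)/(vi): `ℤ̂`-valued characters of `Ĝ` and the closed procyclic
# subgroup `T̂_x` topologically generated by `x`

Mochizuki, *Inter-universal Teichmüller theory I*, kurims manuscript (May 2020), §2, proof of
Lemma 2.7 (vi), p. 59: *"there exist a finite index subgroup `G₁ ⊆ G` equipped with a surjection
`β : G₁ ↠ ℤ × ℤ` and elements `x, y ∈ N ∩ G₁` such that `β(x) = (1,0)` and `β(y) = (0,1)`.  In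
particular, it follows from assertion (v) that the closed subgroups `T̂_x, T̂_y ⊆ Ĝ` topologically
generated by `x` and `y`, respectively, are normally terminal in the profinite completion `Ĝ₁`"*
[cite: Mochizuki2012, Lem 2.7(vi) p.59] (D-0012 claim key, status disputed — the content here is plain
profinite group theory and takes no side).  To APPLY the typed statement of Lemma 2.7 (v)
(`FreeOrSurface.zHatQuotientNormallyTerminal`: "a closed `T̂ ⊆ Ĝ` such that there exists a continuous
surjection `Ĝ ↠ ℤ̂` that induces an isomorphism `T̂ ⥲ ℤ̂` is normally terminal") one needs exactly:

* `ProfiniteCompletion.exists_zHat_extension` — a character `f : G → ℤ` extends to a CONTINUOUS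
  homomorphism `φ : Ĝ → ℤ̂` with `φ ∘ η_G = η_ℤ ∘ f` (the completion functor on `β`; built
  componentwise in `ℤ̂ = lim ℤ/n` from the finite-level lifts `exists_lift_of_finite`, coherence by
  density of `η_G(G)` — this avoids the universe restriction of `ProfiniteGrp.ProfiniteCompletion.lift`,
  whose target must live in the universe of `G` while `ℤ̂` lives in `Type`);
* `ProfiniteCompletion.bijective_zHat_closure_zpowers` — if `f x = 1 ∈ ℤ`, then `φ` restricts to a
  BIJECTION from `T̂_x :=` the closure of `⟨η x⟩` onto `ℤ̂` ("induces an isomorphism `T̂_x ⥲ ℤ̂`");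
* `commute_of_mem_topologicalClosure_zpowers` — an element commuting with `η x` commutes with `T̂_x`.

Proof-only plumbing (no definitions, no statement of the tree restated); every item carries the
locator of the printed step it serves.
-/

namespace Literature.IUT.HodgeTheaters

open CategoryTheory ProfiniteGrp ProfiniteGrp.ProfiniteCompletion Topology Multiplicative

universe u

/-- An element commuting with `a` commutes with every element of the closed subgroup topologically
generated by `a` (the centralizer of a point is closed). [cite: Mochizuki2012, Lem 2.7(vi) p.59] -/
theorem commute_of_mem_topologicalClosure_zpowers {P : Type*} [Group P] [TopologicalSpace P]
    [IsTopologicalGroup P] [T2Space P] {a z : P} (h : Commute z a) {t : P}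
    (ht : t ∈ (Subgroup.zpowers a).topologicalClosure) : Commute z t := by
  let C : Subgroup P := Subgroup.centralizer ({z} : Set P)
  have hC : ∀ w : P, w ∈ C ↔ z * w = w * z := fun w => by
    rw [Subgroup.mem_centralizer_iff]
    simp only [Set.mem_singleton_iff, forall_eq]
  have hle : Subgroup.zpowers a ≤ C := Subgroup.zpowers_le.mpr ((hC a).mpr h.eq)
  have hclosed : IsClosed (C : Set P) := by
    have e : (C : Set P) = {w | z * w = w * z} := Set.ext fun w => hC w
    rw [e]
    exact isClosed_eq (continuous_const.mul continuous_id) (continuous_id.mul continuous_const)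
  exact (hC t).mp (Subgroup.topologicalClosure_minimal _ hle hclosed ht)

namespace ProfiniteCompletion

variable {K : Type u} [Group K]

/-- **`ℤ̂`-valued extension of an integral character** ("equipped with a surjection `β : G₁ ↠ ℤ × ℤ`",
p. 59, read on the profinite completion): every homomorphism `f : K → ℤ` extends to a continuous
homomorphism `φ : K̂ → ℤ̂` with `φ (η_K k) = η_ℤ (f k)`.  Built componentwise: at the level `ℤ/L` of
`ℤ̂ = lim ℤ/L` the component is the finite-level lift of `K → ℤ → ℤ/L`; coherence of the components
holds on the dense subgroup `η_K(K)` and hence everywhere. [cite: Mochizuki2012, Lem 2.7(vi) p.59] -/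
theorem exists_zHat_extension (f : K →* Multiplicative ℤ) :
    ∃ φ : profiniteCompletion K →* ZHat, Continuous φ ∧
      ∀ k : K, φ (toCompletion K k) = toCompletion (Multiplicative ℤ) (f k) := by
  classical
  -- finite-level lifts `fl L : K̂ → ℤ/L`
  have hlev : ∀ L : FiniteIndexNormalSubgroup (Multiplicative ℤ),
      ∃ fl : profiniteCompletion K →* (diagram (GrpCat.of (Multiplicative ℤ))).obj L,
        (∀ k : K, fl (toCompletion K k) = (QuotientGroup.mk (f k) : Multiplicative ℤ ⧸ L.toSubgroup)) ∧
        Continuous fl := by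
    intro L
    obtain ⟨fl, hflη, -, hflc⟩ :=
      exists_lift_of_finite (G := K) ((QuotientGroup.mk' L.toSubgroup).comp f)
    haveI : DiscreteTopology ((diagram (GrpCat.of (Multiplicative ℤ))).obj L) := ⟨rfl⟩
    exact ⟨fl, fun k => hflη k, hflc⟩
  choose fl hflη hflc using hlev
  -- coherence, by density of `η_K(K)`
  have hcoh : ∀ (x : profiniteCompletion K) (L L' : FiniteIndexNormalSubgroup (Multiplicative ℤ))
      (π : L ⟶ L'), (diagram (GrpCat.of (Multiplicative ℤ))).map π (fl L x) = fl L' x := by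
    intro x L L' π
    haveI : DiscreteTopology ((diagram (GrpCat.of (Multiplicative ℤ))).obj L) := ⟨rfl⟩
    haveI : DiscreteTopology ((diagram (GrpCat.of (Multiplicative ℤ))).obj L') := ⟨rfl⟩
    let g₁ : profiniteCompletion K → (diagram (GrpCat.of (Multiplicative ℤ))).obj L' :=
      fun y => (diagram (GrpCat.of (Multiplicative ℤ))).map π (fl L y)
    have h1 : Continuous g₁ :=
      (continuous_of_discreteTopology
        (f := fun w : (diagram (GrpCat.of (Multiplicative ℤ))).obj L =>
          (diagram (GrpCat.of (Multiplicative ℤ))).map π w)).comp (hflc L)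
    have h2 : Continuous (fl L') := hflc L'
    have heq : g₁ = fl L' := by
      refine (denseRange (GrpCat.of K)).equalizer h1 h2 (funext fun k => ?_)
      change (diagram (GrpCat.of (Multiplicative ℤ))).map π (fl L (toCompletion K k)) =
        fl L' (toCompletion K k)
      rw [hflη L k, hflη L' k]
      rfl
    exact congrFun heq x
  -- the extension
  let φf : profiniteCompletion K → ZHat := fun x => ⟨fun L => fl L x, fun L L' π => hcoh x L L' π⟩
  let φ : profiniteCompletion K →* ZHat :=
    { toFun := φf
      map_one' := Subtype.ext (funext fun L => by
        change fl L 1 = 1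
        exact map_one (fl L))
      map_mul' := fun x y => Subtype.ext (funext fun L => by
        change fl L (x * y) = fl L x * fl L y
        exact map_mul (fl L) x y) }
  refine ⟨φ, ?_, fun k => ?_⟩
  · exact Continuous.subtype_mk (continuous_pi fun L => hflc L) _
  · apply Subtype.ext
    funext L
    change fl L (toCompletion K k) = (QuotientGroup.mk (f k) : Multiplicative ℤ ⧸ L.toSubgroup)
    exact hflη L k

/-- **"`β` induces an isomorphism `T̂_x ⥲ ℤ̂`"** (the hypothesis of Lemma 2.7 (v) for the closed
procyclic subgroup `T̂_x` topologically generated by `η x`, p. 59): if `φ : K̂ → ℤ̂` is a continuous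
homomorphism extending `f : K → ℤ` and `f x = 1`, then `φ` restricted to the closure `T̂_x` of `⟨η x⟩`
is a bijection onto `ℤ̂`.  Injectivity componentwise: a point `t ∈ T̂_x` with `φ t = 1` has, at each
level `N`, component `x^a · N` with `[K : N] ∣ a`; surjectivity: the image is compact and contains the
dense subgroup `η_ℤ(ℤ)`. [cite: Mochizuki2012, Lem 2.7(vi) p.59] -/
theorem bijective_zHat_closure_zpowers (f : K →* Multiplicative ℤ) (x : K) (hx : f x = ofAdd 1)
    (φ : profiniteCompletion K →* ZHat) (hφc : Continuous φ)
    (hφ : ∀ k : K, φ (toCompletion K k) = toCompletion (Multiplicative ℤ) (f k)) :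
    Function.Bijective
      (φ.comp (Subgroup.zpowers (toCompletion K x)).topologicalClosure.subtype) := by
  classical
  set T := (Subgroup.zpowers (toCompletion K x)).topologicalClosure with hT
  -- values of `φ` on powers of `η x`
  have hφpow : ∀ a : ℤ, φ (toCompletion K x ^ a) = toCompletion (Multiplicative ℤ) (ofAdd a) := by
    intro a
    rw [map_zpow, hφ, hx, ← map_zpow, ← ofAdd_zsmul, smul_eq_mul, mul_one]
  constructor
  · -- injectivity: trivial kernel on `T`
    rw [injective_iff_map_eq_one]
    rintro ⟨t, ht⟩ hφt
    change φ t = 1 at hφt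
    apply Subtype.ext
    change t = 1
    apply Subtype.ext
    funext N
    change t.val N = 1
    -- the level `N` of `K̂` and the level `m = [K : N]` of `ℤ̂`
    obtain ⟨m, hm⟩ : ∃ m, m = Nat.card (K ⧸ N.toSubgroup) := ⟨_, rfl⟩
    haveI : NeZero m := ⟨hm ▸ Nat.card_pos.ne'⟩
    obtain ⟨ρ, hρη, -, hρc⟩ :=
      exists_lift_of_finite (G := Multiplicative ℤ) ((Int.castAddHom (ZMod m)).toMultiplicative)
    have hρc' : Continuous ρ := hρc
    haveI : DiscreteTopology ((diagram (GrpCat.of K)).obj N) := ⟨rfl⟩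
    let Φ : profiniteCompletion K → (diagram (GrpCat.of K)).obj N × Multiplicative (ZMod m) :=
      fun y => (y.val N, ρ (φ y))
    have hΦc : Continuous Φ := (continuous_val N).prodMk (hρc'.comp hφc)
    -- `t` is approximated by a power `(η x)^a` at this pair of levels
    have ht' : t ∈ closure ((Subgroup.zpowers (toCompletion K x) : Set (profiniteCompletion K))) := by
      rw [← Subgroup.topologicalClosure_coe]; exact ht
    obtain ⟨y, hyΦ, hy⟩ :=
      mem_closure_iff.mp ht' (Φ ⁻¹' {Φ t}) ((isOpen_discrete _).preimage hΦc) rfl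
    obtain ⟨a, rfl⟩ := Subgroup.mem_zpowers_iff.mp hy
    have hyΦ' : Φ (toCompletion K x ^ a) = Φ t := hyΦ
    have h1 : (toCompletion K x ^ a).val N = t.val N := congrArg Prod.fst hyΦ'
    have h2 : ρ (φ (toCompletion K x ^ a)) = ρ (φ t) := congrArg Prod.snd hyΦ'
    -- `φ t = 1` forces `m ∣ a`
    rw [hφt, map_one, hφpow, hρη] at h2
    change ofAdd ((a : ZMod m)) = 1 at h2
    rw [ofAdd_eq_one, ZMod.intCast_zmod_eq_zero_iff_dvd] at h2
    -- hence the `N`-component `x^a · N` of `t` is trivial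
    rw [← h1, ← map_zpow, toCompletion_val, QuotientGroup.mk_zpow]
    have hord : (orderOf (QuotientGroup.mk x : K ⧸ N.toSubgroup) : ℤ) ∣ a :=
      (Int.natCast_dvd_natCast.mpr (hm ▸ orderOf_dvd_natCard _)).trans h2
    exact orderOf_dvd_iff_zpow_eq_one.mp hord
  · -- surjectivity: the image of `T` is compact and contains the dense subgroup `η_ℤ(ℤ)`
    have hTc : IsCompact (T : Set (profiniteCompletion K)) :=
      (Subgroup.isClosed_topologicalClosure _).isCompact
    have hclosed : IsClosed (φ '' (T : Set (profiniteCompletion K))) := (hTc.image hφc).isClosed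
    have hsub : Set.range (toCompletion (Multiplicative ℤ)) ⊆ φ '' (T : Set (profiniteCompletion K)) := by
      rintro _ ⟨z, rfl⟩
      refine ⟨toCompletion K x ^ (toAdd z), ?_, ?_⟩
      · exact Subgroup.le_topologicalClosure _ (Subgroup.zpow_mem_zpowers _ _)
      · rw [hφpow, ofAdd_toAdd]
    have hdense : Dense (φ '' (T : Set (profiniteCompletion K))) :=
      (denseRange (GrpCat.of (Multiplicative ℤ))).mono hsub
    have huniv : φ '' (T : Set (profiniteCompletion K)) = Set.univ := by
      rw [← hclosed.closure_eq]; exact hdense.closure_eq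
    intro w
    obtain ⟨t, ht, htw⟩ : w ∈ φ '' (T : Set (profiniteCompletion K)) := by rw [huniv]; trivial
    exact ⟨⟨t, ht⟩, htw⟩

/-- The surjectivity clause alone: under the same hypotheses `φ : K̂ → ℤ̂` is surjective ("a
continuous surjection `Ĝ ↠ ℤ̂`", the first hypothesis of Lemma 2.7 (v)). [cite: Mochizuki2012, Lem 2.7(v) p.57] -/
theorem surjective_zHat_of_apply_eq_one (f : K →* Multiplicative ℤ) (x : K) (hx : f x = ofAdd 1)
    (φ : profiniteCompletion K →* ZHat) (hφc : Continuous φ)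
    (hφ : ∀ k : K, φ (toCompletion K k) = toCompletion (Multiplicative ℤ) (f k)) :
    Function.Surjective φ := fun w => by
  obtain ⟨t, ht⟩ := (bijective_zHat_closure_zpowers f x hx φ hφc hφ).2 w
  exact ⟨t.1, ht⟩

end ProfiniteCompletion

end Literature.IUT.HodgeTheaters
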